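/-
Copyright (c) 2026 the pub-hodgecm-mathlib formalisation cell (harness21).  Prover seat hodgecm-mathlib-K2Liu-p11 (g0), Track B «K2-LIT»,
#184♮ = hLiu418 = `stmt-HodgeConjecture-24832`; LEAD F0P6-plan (g12) RULING M-156n (4) «A∞ ORGAN» 2026-09-04T08:09:40Z + K2E5-plan (g6)
08:24:53Z «= (D∞) in the definition lane, TUBE frame = currency of record for `I_w(s,χ_w)` at a complex place».  DEFINITIONS WITH BODIES +
elementary proved lemmas; no `instance`, no notation, no named-fact hypothesis, no `sorry`.
-/
import Summits.HodgeConjecture.HodgeConjecture.Theorems.K2LiuHermitianTubeAction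
import Mathlib.MeasureTheory.Integral.Bochner.Basic
import Mathlib.Analysis.SpecialFunctions.Pow.Complex
import HarnessLib

/-!
# Crux `HLiu418`, the A∞ organ, DEFS leaf (D∞): the archimedean degenerate principal series of `U(n,n)` at a complex place, in the
# TUBE frame — Siegel sections, the scalar-type vectors, and the intertwining integral over `N_Δ(ℂ) ≅ Herm_n(ℂ)`

Cell `hodgecm-mathlib`, crux item hLiu418 = `stmt-HodgeConjecture-24832` (helper ∕ definition lane, count-neutral).

Frame of record (★ H1-A `K2LiuHermitianTubeCocycle`, ★ H1-B `K2LiuHermitianTubeAction`, ★ H1-C): `U(J) = {g | gᴴ J g = J}`,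
`J = Matrix.J l ℂ`; Siegel parabolic `P_Δ = {g₂₁ = 0}` with Levi blocks `(A, A⁻ᴴ)`; `N_Δ = {transl b = (1 b; 0 1) | bᴴ = b} ≅ Herm_l(ℂ)`;
`w_Δ = J`; `denom g Z = g₂₁ Z + g₂₂`, `j(g, Z) = det (denom g Z)`, base point `i·1`.
* `hermOfReal r` — explicit real coordinates `(l → l → ℝ) → Herm_l(ℂ)`, `r ↦ (r_{ij} + r_{ji}) + (r_{ij} − r_{ji}) i` (hermitian, `ℝ`-linear,
  injective, onto the hermitian matrices: `conjTranspose_hermOfReal`, `hermOfReal_add/smul/injective`, `exists_hermOfReal_eq`); Lebesgue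
  measure on `l → l → ℝ` is the Haar measure of `N_Δ(ℂ)` of record (a positive constant away from any other normalisation).
* `IsArchSiegelSection χ s f` — the parabolic law of `I_w(s, χ)`: `f (p g) = χ(det A_p) · ‖det A_p‖^{2s + l} · f g` for `p ∈ U(J) ∩ P_Δ`
  (`A_p = p₁₁`; `‖·‖^{2s+l}` = `|·|_ℂ^{s + l/2}`, `|z|_ℂ = |z|²`, `ρ_{P_Δ} = l/2` in `|·|_ℂ`-units).
* `archScalarSection k s g = j(g, i1)^{−k} · ‖j(g, i1)‖^{k − 2s − l}` — the SCALAR `K_w`-type vector of weight `k` (it lies in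
  `I_w(s, χ_k)`, `χ_k(z) = (z̄/‖z‖)^k`; proved in (A∞-0)); `archScalarSection_apply`.
* `archIntertwining f g = ∫ r, f (J · transl (hermOfReal r) · g)` — the intertwining integral `M_w f (g) = ∫_{N_Δ(ℂ)} f (w_Δ n g) dn`
  (Bochner integral over `l → l → ℝ`; `= 0` when not integrable, as usual); `archIntertwining_apply`.
General `n`-edition of the base Γ-integral: [Shimura1982, (1.16)] (acq-15218, OPEN — noted, not blocked on; the programme needs `l = Fin 2`).
References: [Shimura1997, §§5–6, §16] (Kudla–Rallis 1988 §§1–2 and Lee 1994 describe the same series; their structure results are NOT used here).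
HONEST LABEL: HC_CM is proved only modulo the 7 printed citations (2 remaining named inputs: hLiu418 = stmt-HodgeConjecture-24832,
h413 = stmt-HodgeConjecture-24833) until rung 0 closes; definitions + helper lemmas, closes no socket.
-/

set_option autoImplicit false
set_option linter.dupNamespace false

noncomputable section

open scoped Matrix ComplexConjugate
open MeasureTheory Complex Matrix
open Literature.NumberTheory.ModularForms.SiegelUpperHalfSpace (num denom moeb denom_def)

namespace Summit.HodgeConjecture.HodgeConjecture.Cruxes.HLiu418.K2LiuArchInducedTubeDefs

variable {l : Type*} [Fintype l] [DecidableEq l]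

/-! ## 1. Real coordinates on the hermitian matrices (`N_Δ(ℂ) ≅ Herm_l(ℂ) ≅ ℝ^{l×l}`) -/

/-- **Hermitian coordinates**: `hermOfReal r = (r_{ij} + r_{ji}) + (r_{ij} − r_{ji})·i` — a real-linear bijection from `l → l → ℝ` onto the
hermitian `l × l` matrices (diagonal `2 r_{ii}`, real parts from the symmetric part, imaginary parts from the antisymmetric part).
[cite: Shimura1997, §5.6] -/
def hermOfReal (r : l → l → ℝ) : Matrix l l ℂ :=
  Matrix.of fun i j => (((r i j + r j i : ℝ) : ℂ) + ((r i j - r j i : ℝ) : ℂ) * I)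

omit [Fintype l] [DecidableEq l] in
/-- Entries of `hermOfReal`. [folklore] -/
theorem hermOfReal_apply (r : l → l → ℝ) (i j : l) :
    hermOfReal r i j = ((r i j + r j i : ℝ) : ℂ) + ((r i j - r j i : ℝ) : ℂ) * I := rfl

omit [Fintype l] [DecidableEq l] in
/-- `hermOfReal r` is hermitian. [folklore] -/
theorem conjTranspose_hermOfReal (r : l → l → ℝ) : (hermOfReal r)ᴴ = hermOfReal r := by
  ext i j
  rw [conjTranspose_apply, hermOfReal_apply, hermOfReal_apply]
  simp only [star_add, star_mul, Complex.star_def, Complex.conj_ofReal, Complex.conj_I]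
  push_cast
  ring

omit [Fintype l] [DecidableEq l] in
/-- `hermOfReal` is additive. [folklore] -/
theorem hermOfReal_add (r r' : l → l → ℝ) : hermOfReal (r + r') = hermOfReal r + hermOfReal r' := by
  ext i j
  simp only [hermOfReal_apply, Pi.add_apply, Matrix.add_apply]
  push_cast
  ring

omit [Fintype l] [DecidableEq l] in
/-- `hermOfReal` is `ℝ`-homogeneous. [folklore] -/
theorem hermOfReal_smul (a : ℝ) (r : l → l → ℝ) : hermOfReal (a • r) = a • hermOfReal r := by
  ext i j
  simp only [hermOfReal_apply, Pi.smul_apply, Matrix.smul_apply, smul_eq_mul, Complex.real_smul]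
  push_cast
  ring

omit [Fintype l] [DecidableEq l] in
/-- `hermOfReal 0 = 0`. [folklore] -/
theorem hermOfReal_zero : hermOfReal (0 : l → l → ℝ) = 0 := by
  ext i j
  simp [hermOfReal_apply]

omit [Fintype l] [DecidableEq l] in
/-- `hermOfReal` is injective. [folklore] -/
theorem hermOfReal_injective : Function.Injective (hermOfReal (l := l)) := by
  intro r r' h
  funext i j
  have hij := congrFun (congrFun h i) j
  rw [hermOfReal_apply, hermOfReal_apply] at hij
  have h1 := congrArg Complex.re hij
  have h2 := congrArg Complex.im hij
  simp only [Complex.add_re, Complex.ofReal_re, Complex.mul_re, Complex.I_re, Complex.I_im, Complex.ofReal_im,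
    mul_zero, mul_one, sub_zero, Complex.add_im, Complex.mul_im, zero_add, add_zero] at h1 h2
  linarith

omit [Fintype l] [DecidableEq l] in
/-- Every hermitian matrix is a `hermOfReal r`. [folklore] -/
theorem exists_hermOfReal_eq {b : Matrix l l ℂ} (hb : bᴴ = b) : ∃ r : l → l → ℝ, hermOfReal r = b := by
  refine ⟨fun i j => (b i j).re / 2 + (b i j).im / 2, ?_⟩
  ext i j
  rw [hermOfReal_apply]
  have hji : b j i = star (b i j) := by rw [← conjTranspose_apply, hb]
  have hre : (b j i).re = (b i j).re := by rw [hji, Complex.star_def, Complex.conj_re]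
  have him : (b j i).im = -(b i j).im := by rw [hji, Complex.star_def, Complex.conj_im]
  simp only [hre, him]
  apply Complex.ext <;> simp <;> ring

/-! ## 2. Siegel sections of `I_w(s, χ)` in the tube frame -/

/-- **Archimedean Siegel sections (tube frame).**  `f : M_{2l}(ℂ) → ℂ` satisfies the parabolic law of the degenerate principal series
`I_w(s, χ)` of `U(l,l)`: for `p ∈ U(J)` in the Siegel parabolic (`p₂₁ = 0`, Levi block `A_p = p₁₁`) and any `g`,
`f (p g) = χ(det A_p) · ‖det A_p‖^{2s + l} · f g` (`‖·‖^{2s+l} = |·|_ℂ^{s + l/2}`).  Only the values of `f` on `U(J)` matter downstream.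
[cite: Shimura1997, §16] -/
def IsArchSiegelSection (χ : ℂ → ℂ) (s : ℂ) (f : Matrix (l ⊕ l) (l ⊕ l) ℂ → ℂ) : Prop :=
  ∀ p g : Matrix (l ⊕ l) (l ⊕ l) ℂ, pᴴ * Matrix.J l ℂ * p = Matrix.J l ℂ → p.toBlocks₂₁ = 0 →
    f (p * g) = χ p.toBlocks₁₁.det * (((‖p.toBlocks₁₁.det‖ : ℝ) : ℂ) ^ (2 * s + (Fintype.card l : ℂ))) * f g

/-- **The scalar-type vector of weight `k`**: `f⁰_{s,k}(g) = j(g, i1)^{−k} · ‖j(g, i1)‖^{k − 2s − l}`, `j(g,Z) = det (denom g Z)`.  It is the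
(unique up to scalar) vector of `K_w`-type `u ↦ j(u, i1)^{−k}` in `I_w(s, χ_k)`, `χ_k(z) = (z̄/‖z‖)^k` — the archimedean component of
the weight-`k` holomorphic Siegel–Weil sections (parabolic law and `K_w`-type proved in (A∞-0)). [cite: Shimura1997, §16.4] -/
def archScalarSection (k : ℤ) (s : ℂ) (g : Matrix (l ⊕ l) (l ⊕ l) ℂ) : ℂ :=
  (denom g (I • (1 : Matrix l l ℂ))).det ^ (-k) *
    (((‖(denom g (I • (1 : Matrix l l ℂ))).det‖ : ℝ) : ℂ) ^ ((k : ℂ) - 2 * s - (Fintype.card l : ℂ)))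

/-- Unfolding of `archScalarSection`. [folklore] -/
theorem archScalarSection_apply (k : ℤ) (s : ℂ) (g : Matrix (l ⊕ l) (l ⊕ l) ℂ) :
    archScalarSection k s g = (denom g (I • (1 : Matrix l l ℂ))).det ^ (-k) *
      (((‖(denom g (I • (1 : Matrix l l ℂ))).det‖ : ℝ) : ℂ) ^ ((k : ℂ) - 2 * s - (Fintype.card l : ℂ))) := rfl

/-- At the identity the scalar-type vector equals `1` (`denom 1 (i1) = 1`). [folklore] -/
theorem archScalarSection_one (k : ℤ) (s : ℂ) : archScalarSection k s (1 : Matrix (l ⊕ l) (l ⊕ l) ℂ) = 1 := by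
  rw [archScalarSection_apply, denom_def, ← fromBlocks_one, toBlocks_fromBlocks₂₁, toBlocks_fromBlocks₂₂, Matrix.zero_mul, zero_add,
    det_one, _root_.one_zpow, norm_one, Complex.ofReal_one, Complex.one_cpow, mul_one]

/-! ## 3. The intertwining integral -/

/-- **The archimedean intertwining integral (tube frame)**: `M_w f (g) = ∫_{N_Δ(ℂ)} f (w_Δ · n · g) dn` with `w_Δ = J`,
`n = transl (hermOfReal r)`, `dn` = Lebesgue measure in the coordinates `r : l → l → ℝ` (Bochner integral; `0` if not integrable).
For Siegel sections of `I_w(s,χ)` with `re s` large it converges and is a Siegel section of `I_w(−s, χ′)`, `χ′(z) = χ(z̄)⁻¹` ((A∞-0)).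
[cite: Shimura1997, §16] -/
def archIntertwining (f : Matrix (l ⊕ l) (l ⊕ l) ℂ → ℂ) (g : Matrix (l ⊕ l) (l ⊕ l) ℂ) : ℂ :=
  ∫ r : l → l → ℝ, f (Matrix.J l ℂ * fromBlocks 1 (hermOfReal r) 0 1 * g)

/-- Unfolding of `archIntertwining`. [folklore] -/
theorem archIntertwining_apply (f : Matrix (l ⊕ l) (l ⊕ l) ℂ → ℂ) (g : Matrix (l ⊕ l) (l ⊕ l) ℂ) :
    archIntertwining f g = ∫ r : l → l → ℝ, f (Matrix.J l ℂ * fromBlocks 1 (hermOfReal r) 0 1 * g) := rfl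

/-- The integrand's group elements lie in `U(J)`: `J · transl (hermOfReal r) ∈ U(J)`. [cite: Shimura1997, §5] -/
theorem J_mul_transl_hermOfReal_mem (r : l → l → ℝ) :
    (Matrix.J l ℂ * fromBlocks 1 (hermOfReal r) 0 1)ᴴ * Matrix.J l ℂ * (Matrix.J l ℂ * fromBlocks 1 (hermOfReal r) 0 1) = Matrix.J l ℂ :=
  K2LiuHermitianTubeCocycle.mul_mem_UJ K2LiuHermitianTubeCocycle.J_mem
    ((K2LiuHermitianTubeCocycle.transl_mem_iff _).2 (conjTranspose_hermOfReal r))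

end Summit.HodgeConjecture.HodgeConjecture.Cruxes.HLiu418.K2LiuArchInducedTubeDefs

end
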